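import Literature.NumberTheory.EllipticCurves.NeronIsogenyScalingProofs
import Literature.NumberTheory.EllipticCurves.IsogenyBaseChange
import HarnessLib

/-!
# The `x`-coordinate of an isogeny is the rational transformation attached to its analytic
# multiplier (Silverman *AEC* Thm. VI.4.1(b), III.4)

`Proofs` file (theorems only, no definitions, no named facts), topic `NumberTheory/EllipticCurves`.
The tree's `Literature.NumberTheory.EllipticCurves.exists_isogeny_x_eq_of_forall_mul_mem_lattice`
(`NeronIsogenyScalingProofs`) builds, from a lattice inclusion `cΛ₁ ⊆ Λ₂` between the Néron-type
period lattices of two Weierstrass models over `ℚ`, SOME `ℚ`-isogeny `W₁ → W₂` whose `x`-coordinate is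
`A(x)/B(x)` with `A, B ∈ ℚ[X]`, `B` monic, `deg A = deg B + 1`, `lc A = c⁻²`.  This file proves the
same formula for a GIVEN isogeny `ψ : W₁ → W₂` and its ANALYTIC MULTIPLIER `k`
(`ψ_ℂ(u₁(z)) = u₂(kz)` for the complex uniformisations, Silverman *AEC* VI.4.1(b); the tree
produces `k ∈ ℚ` with `kΛ₁ ⊆ Λ₂` and this property in
`WeierstrassCurve.Isogeny.exists_algebraMap_card_ker_inf_realPoints_mul_realPeriod_eq`):

* `WeierstrassCurve.Isogeny.exists_x_formula_of_baseChange_apply_eq` — **for every affine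
  `P = (x, y) ∈ W₁(ℚ̄)` with `ψ P ≠ O`: `x(ψ P) = A(x)/B(x)`** (`B(x) ≠ 0`) for polynomials
  `A, B ∈ ℚ[X]` with `B` monic, `deg A = deg B + 1` and **`lc A = k⁻²`**.

Proof: the `x`-coordinate of `u₂(kz)` is `℘_{Λ₂}(kz) − b₂′/12 = k⁻²℘_{k⁻¹Λ₂}(z) − b₂′/12`, and
`℘_{k⁻¹Λ₂} = (P₀/Q₀)(℘_{Λ₁})` with `P₀, Q₀ ∈ ℚ[X]`, `deg P₀ = deg Q₀ + 1`, `lc P₀ = lc Q₀ = 1`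
(`PeriodPair.exists_rat_polynomial_weierstrassP_mul_eval_eq_of_le`,
`PeriodPair.natDegree_eq_succ_of_weierstrassP_mul_eval_eq`); in Weierstrass coordinates
(`x = ℘ − b₂/12`) this is the tree's `map_some_eq_uniformize_mul_of_transformation`, read back on
`ℚ̄`-points through the injectivity of `E(ℚ̄) → E(ℂ)` and `ψ_ℂ ∘ j_* = j_* ∘ ψ`
(`Isogeny.baseChange_map`).  So `x ∘ ψ = k⁻²x + O(1)` near `O`: in terms of invariant differentials
`ψ^*(dx′/(2y′ + a₁′x′ + a₃′)) = ±k · dx/(2y + a₁x + a₃)` (AEC III.5).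

Use (cell `b2b-bsdres`, X2 lineage): the `p`-adic size of `x(ψ P)` for `P` deep in the kernel of
reduction is `|k|⁻²|x(P)|`, the coordinate handle on the analytic multiplier in the kernel proof of
Greenberg–Vatsal's period clause Cor. (3.8).

## References

* [SilvermanAEC2009] J. H. Silverman, *The Arithmetic of Elliptic Curves*, 2nd ed., GTM 106
  (2009): Thm. VI.4.1(b), Prop. VI.3.6, III.4, III.5.
-/

noncomputable section

open scoped Classical
open Polynomial Literature.NumberTheory.EllipticCurves _root_.PeriodPair

namespace WeierstrassCurve

variable [Algebra (AlgebraicClosure ℚ) ℂ] [IsScalarTower ℚ (AlgebraicClosure ℚ) ℂ]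

/-- **The `x`-coordinate of an isogeny from its analytic multiplier.**  Let `ψ : W₁ → W₂` be an
isogeny of Weierstrass models over `ℚ` (`W₁` elliptic), `Λ₁, Λ₂` period lattices of Néron type
(`g₂ = c₄/12`, `g₃ = c₆/216`) with uniformisations `u₁, u₂` (`u₁` onto,
`uᵢ(z) = (℘_{Λᵢ}(z) − b₂/12, (℘′_{Λᵢ}(z) − a₁x − a₃)/2)` off `Λᵢ`, `ker u₂ = Λ₂`), and `k ∈ ℚˣ`
with `kΛ₁ ⊆ Λ₂` and `ψ_ℂ(u₁ z) = u₂(kz)` for all `z` (the analytic multiplier, Silverman *AEC*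
VI.4.1(b)).  Then there are `A, B ∈ ℚ[X]`, `B` monic, `deg A = deg B + 1`, `lc A = k⁻²`, such that
for every affine `P = (x, y) ∈ W₁(ℚ̄)` with `ψ P ≠ O`: `B(x) ≠ 0` and `x(ψ P) = A(x)/B(x)`.
[cite: SilvermanAEC2009, Thm. VI.4.1(b)] -/
theorem Isogeny.exists_x_formula_of_baseChange_apply_eq {W₁ W₂ : WeierstrassCurve ℚ}
    [W₁.IsElliptic] (ψ : Isogeny W₁ W₂) {L₁ L₂ : PeriodPair}
    (h₁₂ : L₁.g₂ = (W₁.baseChange ℂ).c₄ / 12) (h₁₃ : L₁.g₃ = (W₁.baseChange ℂ).c₆ / 216)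
    (h₂₂ : L₂.g₂ = (W₂.baseChange ℂ).c₄ / 12) (h₂₃ : L₂.g₃ = (W₂.baseChange ℂ).c₆ / 216)
    {u₁ : ℂ →+ (W₁.baseChange ℂ).toAffine.Point} (hsurj₁ : Function.Surjective u₁)
    (hu₁ : ∀ z ∉ L₁.lattice, ∃ hz, u₁ z = .some (℘[L₁] z - (W₁.baseChange ℂ).b₂ / 12)
        ((℘'[L₁] z - (W₁.baseChange ℂ).a₁ * (℘[L₁] z - (W₁.baseChange ℂ).b₂ / 12) -
          (W₁.baseChange ℂ).a₃) / 2) hz)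
    {u₂ : ℂ →+ (W₂.baseChange ℂ).toAffine.Point} (hker₂ : (u₂.ker : Set ℂ) = L₂.lattice)
    (hu₂ : ∀ z ∉ L₂.lattice, ∃ hz, u₂ z = .some (℘[L₂] z - (W₂.baseChange ℂ).b₂ / 12)
        ((℘'[L₂] z - (W₂.baseChange ℂ).a₁ * (℘[L₂] z - (W₂.baseChange ℂ).b₂ / 12) -
          (W₂.baseChange ℂ).a₃) / 2) hz)
    {k : ℚ} (hk : k ≠ 0) (hle : ∀ z ∈ L₁.lattice, algebraMap ℚ ℂ k * z ∈ L₂.lattice)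
    (happ : ∀ z, ψ.baseChange (u₁ z) = u₂ (algebraMap ℚ ℂ k * z)) :
    ∃ A B : ℚ[X], B.Monic ∧ A.natDegree = B.natDegree + 1 ∧ A.leadingCoeff = k⁻¹ ^ 2 ∧
      ∀ (x y : AlgebraicClosure ℚ)
        (h : (W₁.baseChange (AlgebraicClosure ℚ)).toAffine.Nonsingular x y),
        ψ (Affine.Point.some x y h) ≠ 0 →
        aeval x B ≠ 0 ∧ ∃ (y₂ : AlgebraicClosure ℚ)
          (h₂ : (W₂.baseChange (AlgebraicClosure ℚ)).toAffine.Nonsingular (aeval x A / aeval x B) y₂),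
          ψ (Affine.Point.some x y h) = Affine.Point.some (aeval x A / aeval x B) y₂ h₂ := by
  have hkC' : algebraMap ℚ ℂ k = (k : ℂ) := eq_ratCast _ k
  have hle' : ∀ z ∈ L₁.lattice, (k : ℂ) * z ∈ L₂.lattice := fun z hz ↦ by
    rw [← hkC']; exact hle z hz
  have happ' : ∀ z, ψ.baseChange (u₁ z) = u₂ ((k : ℂ) * z) := fun z ↦ by rw [← hkC']; exact happ z
  have hu₂0 : ∀ w, u₂ w = 0 ↔ w ∈ L₂.lattice := fun w ↦ by
    rw [← SetLike.mem_coe, ← hker₂, SetLike.mem_coe, AddMonoidHom.mem_ker]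
  -- the lattice `Λ' = k⁻¹Λ₂ ⊇ Λ₁`
  have hkC : (k : ℂ) ≠ 0 := by exact_mod_cast hk
  have hki : (k : ℂ)⁻¹ ≠ 0 := inv_ne_zero hkC
  set L' : PeriodPair := L₂.mulLeft ((k : ℂ)⁻¹) hki with hL'def
  have hL' : ∀ z, z ∈ L'.lattice ↔ (k : ℂ) * z ∈ L₂.lattice := fun z ↦ by
    rw [hL'def, PeriodPair.mem_mulLeft_lattice, inv_inv]
  have hLL' : L₁.lattice ≤ L'.lattice := fun z hz ↦ (hL' z).mpr (hle' z hz)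
  have h℘ : ∀ z, ℘[L₂] (k * z) = ((k : ℂ)⁻¹) ^ 2 * ℘[L'] z := fun z ↦ by
    have h := PeriodPair.weierstrassP_mulLeft ((k : ℂ)⁻¹) hki L₂ (k * z)
    rw [inv_mul_cancel_left₀ hkC, ← hL'def] at h
    rw [h, ← mul_assoc, mul_inv_cancel₀ (pow_ne_zero 2 hki), one_mul]
  have h℘' : ∀ z, ℘'[L₂] (k * z) = ((k : ℂ)⁻¹) ^ 3 * ℘'[L'] z := fun z ↦ by
    have h := PeriodPair.derivWeierstrassP_mulLeft ((k : ℂ)⁻¹) hki L₂ (k * z)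
    rw [inv_mul_cancel_left₀ hkC, ← hL'def] at h
    rw [h, ← mul_assoc, mul_inv_cancel₀ (pow_ne_zero 3 hki), one_mul]
  -- the invariants are rational
  have hg₂ : ∃ q : ℚ, (q : ℂ) = L₁.g₂ :=
    ⟨W₁.c₄ / 12, by rw [h₁₂, WeierstrassCurve.baseChange, WeierstrassCurve.map_c₄, eq_ratCast]; push_cast; ring⟩
  have hg₃ : ∃ q : ℚ, (q : ℂ) = L₁.g₃ :=
    ⟨W₁.c₆ / 216, by rw [h₁₃, WeierstrassCurve.baseChange, WeierstrassCurve.map_c₆, eq_ratCast]; push_cast; ring⟩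
  have hg₂' : ∃ q : ℚ, (q : ℂ) = L'.g₂ :=
    ⟨k ^ 4 * W₂.c₄ / 12, by
      rw [hL'def, PeriodPair.g₂_mulLeft, h₂₂, WeierstrassCurve.baseChange, WeierstrassCurve.map_c₄,
        eq_ratCast, inv_pow, inv_inv]; push_cast; ring⟩
  have hg₃' : ∃ q : ℚ, (q : ℂ) = L'.g₃ :=
    ⟨k ^ 6 * W₂.c₆ / 216, by
      rw [hL'def, PeriodPair.g₃_mulLeft, h₂₃, WeierstrassCurve.baseChange, WeierstrassCurve.map_c₆,
        eq_ratCast, inv_pow, inv_inv]; push_cast; ring⟩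
  -- the transformation `℘_{Λ'} = (P₀/Q₀)(℘_{Λ₁})` over `ℚ`, its leading behaviour and derivative
  obtain ⟨P₀, Q₀, hQ₀m, -, hQ', hPQ'⟩ :=
    L₁.exists_rat_polynomial_weierstrassP_mul_eval_eq_of_le L' hLL' hg₂ hg₃ hg₂' hg₃'
  obtain ⟨hdegPQ, hlcPQ⟩ := L₁.natDegree_eq_succ_of_weierstrassP_mul_eval_eq L' hLL'
    (hQ₀m.map (algebraMap ℚ ℂ)).ne_zero hPQ'
  rw [natDegree_map, natDegree_map] at hdegPQ
  rw [leadingCoeff_map, leadingCoeff_map, hQ₀m.leadingCoeff, map_one] at hlcPQ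
  replace hlcPQ : P₀.leadingCoeff = 1 := (algebraMap ℚ ℂ).injective (by rw [hlcPQ, map_one])
  have hQ : ∀ z ∉ L'.lattice, aeval (℘[L₁] z) Q₀ ≠ 0 := fun z hz ↦ by
    rw [← eval_map_algebraMap]; exact hQ' z hz
  have hPQ : ∀ z ∉ L'.lattice, ℘[L'] z * aeval (℘[L₁] z) Q₀ = aeval (℘[L₁] z) P₀ := fun z hz ↦ by
    rw [← eval_map_algebraMap, ← eval_map_algebraMap]; exact hPQ' z hz
  have hder : ∀ z ∉ L'.lattice, ℘'[L'] z * aeval (℘[L₁] z) Q₀ ^ 2 =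
      ℘'[L₁] z * aeval (℘[L₁] z) (derivative P₀ * Q₀ - P₀ * derivative Q₀) := fun z hz ↦ by
    have h := L₁.derivWeierstrassP_mul_eval_sq_eq_of_le L' hLL' hPQ' hz
    rw [Polynomial.derivative_map, Polynomial.derivative_map, ← Polynomial.map_mul,
      ← Polynomial.map_mul, ← Polynomial.map_sub, eval_map_algebraMap, eval_map_algebraMap] at h
    exact h
  -- the polynomials `A, B`
  set βq : ℚ := W₁.b₂ / 12 with hβq
  set β₁ : AlgebraicClosure ℚ := algebraMap ℚ (AlgebraicClosure ℚ) W₁.b₂ / 12 with hβ₁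
  have hT1 : (X + C βq).natDegree = 1 := natDegree_X_add_C βq
  have hT0 : (X + C βq).natDegree ≠ 0 := by rw [hT1]; exact one_ne_zero
  have hBm : (Q₀.comp (X + C βq)).Monic := hQ₀m.comp (monic_X_add_C βq) hT0
  have hBdeg : (Q₀.comp (X + C βq)).natDegree = Q₀.natDegree := by
    rw [natDegree_comp, hT1, mul_one]
  have hPcdeg : (P₀.comp (X + C βq)).natDegree = Q₀.natDegree + 1 := by
    rw [natDegree_comp, hT1, mul_one, hdegPQ]
  have hPclc : (P₀.comp (X + C βq)).leadingCoeff = 1 := by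
    rw [leadingCoeff_comp hT0, hlcPQ, (monic_X_add_C βq).leadingCoeff, one_pow, one_mul]
  have hκ : (k⁻¹ ^ 2 : ℚ) ≠ 0 := pow_ne_zero 2 (inv_ne_zero hk)
  have h1deg : (C (k⁻¹ ^ 2) * P₀.comp (X + C βq)).natDegree = Q₀.natDegree + 1 := by
    rw [natDegree_C_mul hκ, hPcdeg]
  have h1lc : (C (k⁻¹ ^ 2) * P₀.comp (X + C βq)).leadingCoeff = k⁻¹ ^ 2 := by
    rw [leadingCoeff_mul, leadingCoeff_C, hPclc, mul_one]
  have h2deg : (C (W₂.b₂ / 12) * Q₀.comp (X + C βq)).natDegree < Q₀.natDegree + 1 :=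
    lt_of_le_of_lt (natDegree_C_mul_le _ _) (by rw [hBdeg]; exact Nat.lt_succ_self _)
  have hAdeg : (C (k⁻¹ ^ 2) * P₀.comp (X + C βq) -
      C (W₂.b₂ / 12) * Q₀.comp (X + C βq)).natDegree = Q₀.natDegree + 1 := by
    rw [natDegree_sub_eq_left_of_natDegree_lt (h2deg.trans_eq h1deg.symm), h1deg]
  have hAlc : (C (k⁻¹ ^ 2) * P₀.comp (X + C βq) -
      C (W₂.b₂ / 12) * Q₀.comp (X + C βq)).leadingCoeff = k⁻¹ ^ 2 := by
    rw [leadingCoeff_sub_of_degree_lt (degree_lt_degree (h2deg.trans_eq h1deg.symm)), h1lc]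
  have hβ : ∀ x : AlgebraicClosure ℚ, aeval x (X + C βq) = x + β₁ := fun x ↦ by
    rw [hβ₁, hβq, map_add, aeval_X, aeval_C, map_div₀, map_ofNat]
  have hB : ∀ x : AlgebraicClosure ℚ, aeval x (Q₀.comp (X + C βq)) = aeval (x + β₁) Q₀ :=
    fun x ↦ by rw [aeval_comp, hβ]
  have hA : ∀ x : AlgebraicClosure ℚ,
      aeval x (C (k⁻¹ ^ 2) * P₀.comp (X + C βq) - C (W₂.b₂ / 12) * Q₀.comp (X + C βq)) =
        (algebraMap ℚ (AlgebraicClosure ℚ) k)⁻¹ ^ 2 * aeval (x + β₁) P₀ -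
          algebraMap ℚ (AlgebraicClosure ℚ) W₂.b₂ / 12 * aeval (x + β₁) Q₀ := fun x ↦ by
    rw [map_sub, map_mul, map_mul, aeval_C, aeval_C, aeval_comp, aeval_comp, hβ, map_pow,
      map_inv₀, map_div₀, map_ofNat]
  refine ⟨C (k⁻¹ ^ 2) * P₀.comp (X + C βq) - C (W₂.b₂ / 12) * Q₀.comp (X + C βq),
    Q₀.comp (X + C βq), hBm, by rw [hBdeg]; exact hAdeg, hAlc, fun x y h hne ↦ ?_⟩
  -- the embedding `j : ℚ̄ → ℂ` behind `ψ.baseChange`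
  haveI hQbar : Algebra.IsAlgebraic ℚ (AlgebraicClosure ℚ) := AlgebraicClosure.isAlgebraic ℚ
  have hbc : ∀ P : W₁.geomPoints, ψ.baseChange (M := ℂ) (Affine.Point.map (IsScalarTower.toAlgHom ℚ (AlgebraicClosure ℚ) ℂ) P) =
      Affine.Point.map (IsScalarTower.toAlgHom ℚ (AlgebraicClosure ℚ) ℂ) (ψ P) := fun P ↦ ψ.baseChange_map P
  have hjinj : Function.Injective (Affine.Point.map (W' := W₂) (IsScalarTower.toAlgHom ℚ (AlgebraicClosure ℚ) ℂ)) := Affine.Point.map_injective _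
  -- `j_* P = u₁ z` with `z ∉ Λ'` (as `ψ P ≠ O`)
  obtain ⟨z, hz⟩ := hsurj₁ (Affine.Point.map (IsScalarTower.toAlgHom ℚ (AlgebraicClosure ℚ) ℂ) (.some x y h))
  have hzL' : z ∉ L'.lattice := by
    intro hzm
    apply hne
    have h0 : u₂ ((k : ℂ) * z) = 0 := (hu₂0 _).mpr ((hL' z).mp hzm)
    have h1 : Affine.Point.map (IsScalarTower.toAlgHom ℚ (AlgebraicClosure ℚ) ℂ) (ψ (.some x y h)) = 0 :=
      calc Affine.Point.map (IsScalarTower.toAlgHom ℚ (AlgebraicClosure ℚ) ℂ) (ψ (.some x y h))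
          = ψ.baseChange (M := ℂ) (Affine.Point.map (IsScalarTower.toAlgHom ℚ (AlgebraicClosure ℚ) ℂ) (.some x y h)) := (hbc _).symm
        _ = ψ.baseChange (M := ℂ) (u₁ z) := congrArg _ hz.symm
        _ = u₂ ((k : ℂ) * z) := happ' z
        _ = 0 := h0
    exact hjinj (h1.trans (map_zero _).symm)
  obtain ⟨h₂, hh₂⟩ := map_some_eq_uniformize_mul_of_transformation (IsScalarTower.toAlgHom ℚ (AlgebraicClosure ℚ) ℂ) hu₁ hu₂ hle' hL' h℘ h℘'
    hQ hPQ hder h hzL' hz.symm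
  -- read back on `ℚ̄`-points
  have hψP : Affine.Point.map (IsScalarTower.toAlgHom ℚ (AlgebraicClosure ℚ) ℂ) (ψ (.some x y h)) = Affine.Point.map (IsScalarTower.toAlgHom ℚ (AlgebraicClosure ℚ) ℂ) (.some _ _ h₂) :=
    calc Affine.Point.map (IsScalarTower.toAlgHom ℚ (AlgebraicClosure ℚ) ℂ) (ψ (.some x y h))
        = ψ.baseChange (M := ℂ) (Affine.Point.map (IsScalarTower.toAlgHom ℚ (AlgebraicClosure ℚ) ℂ) (.some x y h)) := (hbc _).symm
      _ = ψ.baseChange (M := ℂ) (u₁ z) := congrArg _ hz.symm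
      _ = u₂ ((k : ℂ) * z) := happ' z
      _ = _ := hh₂.symm
  have hψP' := hjinj hψP
  refine ⟨?_, ?_⟩
  · rw [hB]
    intro h0
    apply hQ z hzL'
    -- `j (Q₀(x + β₁)) = Q₀(℘ z)`
    have hz1 : z ∉ L₁.lattice := fun hz1 ↦ hzL' (hLL' hz1)
    obtain ⟨h1, hu1z⟩ := hu₁ z hz1
    have hz' := hz
    rw [hu1z] at hz'
    erw [Affine.Point.map_some] at hz'
    obtain ⟨hx, -⟩ := Affine.Point.some.inj hz'
    have hjt : (IsScalarTower.toAlgHom ℚ (AlgebraicClosure ℚ) ℂ) (x + β₁) = ℘[L₁] z := by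
      rw [map_add, hβ₁, map_div₀, AlgHom.commutes, map_ofNat, ← hx, WeierstrassCurve.baseChange,
        WeierstrassCurve.map_b₂]
      ring
    rw [← hjt, aeval_algHom_apply, h0, map_zero]
  · refine ⟨_, by rw [hA, hB]; exact h₂, ?_⟩
    rw [hψP']
    exact Affine.Point.some.congr_simp _ _ (by rw [hA, hB]) _ _ rfl _

end WeierstrassCurve

end
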